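import Mathlib
import HarnessLib
import HarnessLib.Audit
import Summits.HodgeConjecture.Statement
import Summits.HodgeConjecture.HodgeConjecture.Statement
import Literature.AlgebraicGeometry.HodgeTheory.HodgeConjecture
import Literature.AlgebraicGeometry.HodgeTheory.GysinFormalism
import Literature.AlgebraicGeometry.Motives.FamiliesVHS
import Literature.AlgebraicGeometry.Motives.Sweep1
import Summits.HodgeConjecture.HodgeConjecture.Theorems.CurveNetMordellWeilHodgeModels
import Summits.HodgeConjecture.HodgeConjecture.Theorems.LinearSystemTorelliTranscendentalOrSupportedStubPencil
import HarnessLib.Audit.Status.Attr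

/-!
Route: LimitExtension

DORMANT since 2026-08-26T16:57:20Z (reconciler: no traction for 5.5 d (last activity item-evidence-added at 2026-08-21T05:23:42Z); parked, not closed — `ledger route dormant route-HodgeConjecture-LimitExtension --off` to reactivate) — unstaffed, not closed; items shared with open routes are served there. `ledger route dormant <id> --off` reactivates.

It suffices to show X := LimitExtensionMid ∧ HypersurfaceHodge (card
liaison-limit-extension-ci-universality: "hypersurfaces are universal because every variety is a
degenerate member of the universal hypersurface family").
(LE) LimitExtensionMid: for every smooth projective X of even dimension 2k (k ≥ 1) and every
rational (k,k)-class α in the MIDDLE degree, there are a flat proper family f : W → T over a smooth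
irreducible complex curve, a point t₀, a morphism g : X → W_{t₀} which is an open immersion on a
nonempty open subset of X (so X is birational to an irreducible component of the special fibre;
intended: W_{t₀} ⊇ X' = a generic projection of X to P^{2k+1}, or a broken complete intersection
linked to X), and a rational class B on the total space W(ℂ), such that every other fibre W_t (t ≠
t₀) is a smooth hypersurface of dimension 2k on which B restricts to a class of type (k,k), and α −
(g;ι)^*B lies in N¹H^{2k}(X(ℂ);ℂ) = supportedClasses X (2k) 1 (classes supported on a divisor).
Words: every middle Hodge class is, modulo coniveau 1, the LIMIT of a global family of Hodge classes
living on the smooth members of a one-parameter degeneration of hypersurfaces onto (a birational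
image of) X — i.e. the Hodge loci of the universal hypersurface family accumulate at the boundary
point defined by X.
(HChyp) HypersurfaceHodge: the Hodge conjecture for smooth hypersurfaces of every dimension and
degree (shared verbatim with route FiniteTreeOfFlavours, its target).
Lean: `LimitExtensionMid ∧ HypersurfaceHodge` — both decls of this route; every constant is an
existing declaration (Literature.AlgebraicGeometry.Motives.{SchemeOver, IsSmoothProjective,
IsSmoothHypersurface, ComplexPoints, fiberOver, fiberι},
Literature.AlgebraicGeometry.HodgeTheory.{complexBetti, complexBetti.map, IsRationalClass,
IsOfHodgeType, supportedClasses, algebraicClasses, HodgeConjectureFor, HodgeModel},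
AlgebraicGeometry.{SmoothOfRelativeDimension, Flat, IsProper, IsOpenImmersion}); Sketch.lean
elaborates (lean check rc 0, 12 decls, no sorry); since the 2026-08-15 route-repair no decl of the
route mentions an unproved Literature fact (the Hodge-model existence enters only as the route's own
support item HodgeModels).
## Assembly
Assembly := HodgeModels → LimitExtensionMid → HypersurfaceHodge → HodgeConjecture (the models
antecedent written inline as ∀ n X smooth projective, Nonempty (HodgeModel n X)), propositional
(`fun m a b => g₂ m (g₁ a b)`) from two typed glue lemmas: g₁ = PullbackGlue (LE → HChyp →
MiddleDivisorSupport, from the support SpecialisationOfAlgebraicity: fibrewise-algebraic global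
classes restrict to the birational special component inside Alg + N¹; proof = relative Hilbert/Chow
countability over T, homological invariance of fibres of flat cycles in a tube W_U ≃ W_{t₀},
projection formula, Mayer–Vietoris on the special fibre and the relative homeomorphism (X, Ẽ) → (V,
E') of the normalisation-type map g — Fulton 1998 §10.1/§19.1/§20.3, no Hodge theory) and g₂ =
MiddleDivisorSupportSuffices (HodgeModels → MiddleDivisorSupport → HodgeConjecture: the
Thomas2005Nodes Prop. 2 / DecataldoMigliorini2009 §4 induction on dimension — hyperplane sections
above the middle, Lefschetz pencils + relative Hilbert schemes below it, Deligne Hodge III 8.2.8 +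
semisimplicity in the middle — typed as the supports DivisorInduction / PencilReduction /
HardLefschetzReduction of route NodalSupport, whose decl MiddleDivisorSupport is re-used here
verbatim). Deciding theorem `closes` (D-0027 §2.1): all listed items → HodgeConjecture, proof `h₈
h₁₂ (h₇ h₁ h₂)` = MiddleDivisorSupportSuffices applied to HodgeModels and to PullbackGlue
LimitExtensionMid HypersurfaceHodge. The Hodge-model existence (conjunct 1 of HodgeConjectureFor) is
the route's own support item HodgeModels (= the named fact nonempty_hodgeModel unfolded; shared with
sibling routes), spelled inline in Assembly / MiddleDivisorSupportSuffices / HodgeFourfolds /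
HypersurfacesSufficeOfLE, so the route's constant cone rests on Mathlib and proved tree declarations
only. Milestone on the way: HodgeFourfolds := HodgeModels → LimitExtensionFour →
HypersurfaceHodgeFour → HC for ALL smooth projective fourfolds (the first open dimension), where
HypersurfaceHodgeFour is known for degree ≤ 5 (Zucker1977CubicFourfolds, ConteMurre1978) and open
from the sextic on (FiniteTreeOfFlavours' testbed).

Rationale: WHY THIS LINE. Every smooth projective 2k-fold X is birational (generic projection) to a
hypersurface X' ⊂ P^{2k+1}, and X' IS a degenerate member of the universal family of degree-e
hypersurfaces; the card's idea (stated there with liaison: X a smooth component of a broken complete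
intersection, PeskineSzpiro1974) is to pull the Hodge conjecture back from the smooth members
through the degeneration. We make its pull-back lemma unconditional and typable WITHOUT limit mixed
Hodge structures (Steenbrink1976, CattaniDeligneKaplan1995JAMS enter only the attack on LE, not its
statement): a flat Hodge family near the boundary point with prescribed limit is — up to base
change, CDK finiteness and the fixed-part theorem — a global rational class B on a one-parameter
total space, Hodge on the smooth fibres (for even-dimensional hypersurface fibres H^{2k−1}(W_t) = 0,
so the Wang sequence has no variation part), and the limit condition becomes α − B|_X ∈ N¹. Two
facts make the line honest: (i) HC ⇒ LE trivially (B = 0 and the pencil X' + tG; α algebraic lies in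
N^k ⊆ N¹), so LE is a NECESSARY intermediate, irrefutable short of refuting HC, and (by
contraposition) a new local obstruction to algebraicity of a given class; (ii) the card's own
induction ("closes at Lefschetz (1,1)") is false as stated — the residual class on the double locus
is one below the middle — but the Thomas2005Nodes / DecataldoMigliorini2009 §4 pencil argument
closes it, so X needs only coniveau 1 in the middle degree. Imported area: degenerations / Lefschetz
topology of families (specialisation of cycles, Fulton1998 Ch. 10, 20.3; invariant cycles
DeligneHodgeII1971) joined to the Hodge-locus-at-the-boundary technology
(CattaniDeligneKaplan1995JAMS, BaldiKlinglerUllmo2024, GriffithsHarris1985/CilibertoLopez1991 for k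
= 1) as the attack on LE. No spectral/probabilistic/physical analogy is used. Synergy: this route is
the missing bridge `HypersurfacesSuffice` of route FiniteTreeOfFlavours (filed:
HypersurfacesSufficeOfLE) and re-uses NodalSupport's MiddleDivisorSupport chain.
RANKED CRUXES. #2 LimitExtensionMid — the mechanism (why it might fail: along a general curve
through [X'] the monodromy invariants are ℚh^k, so T must lie in a Hodge-locus component of the
universal hypersurface family whose closure contains a boundary point of EVERY X; for level ≥ 3 (2k
≥ 4, degree ≥ 2k+2) such positive-dimensional components are all atypical and finitely many per
degree (BaldiKlinglerUllmo2024 Thm 2.3/2.6), so LE asks these finitely many special families to be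
universal receptacles as the degree grows; sources CattaniDeligneKaplan1995JAMS,
BaldiKlinglerUllmo2024, GriffithsHarris1985, Steenbrink1976). #3 HypersurfaceHodge — HC for smooth
hypersurfaces, shared with FiniteTreeOfFlavours (why it might fail: it is HC on one family with big
monodromy; open from the sextic fourfold on; sources Deligne2000, Zucker1977CubicFourfolds,
ConteMurre1978, Shioda1979HodgeFermat). #4 LimitExtensionFour — LE for fourfolds, the calibration at
the first open dimension (why it might fail: same as #2 with k = 2; first honest test cases are
fourfolds S × S' carrying a Hodge isometry of transcendental lattices of general-type surfaces,
where HC is open; source GriffithsHarris1985, CilibertoLopez1991, Otwinowska2002). #5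
HypersurfaceHodgeFour — HC for smooth hypersurface fourfolds (why it might fail: open for degree ≥
6, h^{4,0} ≠ 0; sources ConteMurre1978, BaldiKlinglerUllmo2024). With #4 and #5 the support
HodgeFourfolds yields HC for ALL smooth projective fourfolds.
KILL CRITERIA. Every typed crux is implied by HC, so a typed refutation refutes HC itself;
mechanism-level kills: (K1) an IVHS-at-the-boundary computation showing, for a concrete fourfold (X,
α) with HC open, that no Hodge-locus component of the degree-e hypersurface fourfold family passes
through the generic projection [X'] with limit α mod N¹ for all e ≤ e₀ — LE4 then fails in bounded
degree; if it also fails for Veronese re-embeddings and for the liaison/complete-intersection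
presentation, close the route exhausted (and record (X, α) as a candidate HC counterexample); (K2)
FiniteTreeOfFlavours' K1 (a positive-dimensional Hodge-locus component of U_{4,6} not explained by
surface classes) kills #5 in spirit; (K3) a refuter showing the typed LE admits a junk witness (e.g.
a family not forced to contain X in the closure of its smooth fibres) or is NOT implied by HC as
typed — then restate via route edit, not a kill.
NOT DECOMPOSED YET. The infinitesimal form of LE (Hodge locus of the limit Hodge class not contained
in the discriminant: Jacobian-ring IVHS at a generic-projection or liaison boundary point, CDK
nilpotent-orbit analysis, Kato–Usui log period maps) — no Lean vocabulary yet; the LIAISON /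
complete-intersection presentation of the card (X a smooth component of X ∪_D R, fibres smooth
complete intersections: a weaker LE with a stronger partner HC(c.i.); a typed c.i. predicate — prime
ideal + set-theoretic image in P^N — already elaborates in Sketch.lean) is the alternative
decomposition, to be opened as a sibling route if #2 stalls in bounded degree; the negative use of
LE as an obstruction; splits of #2 by (k, degree) and of #3 along FiniteTreeOfFlavours'
movable/rigid dichotomy.
CHEAPEST FALSIFIER. (a) Junk/vacuity audit of the ∃-clauses of LimitExtensionMid (T(ℂ) = {t₀}, W = X
⊔ W', non-reduced special fibre, B = h^k) — the clauses SmoothOfRelativeDimension 1 +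
IrreducibleSpace T + Flat f + open immersion on U ⊆ X are there to exclude each; (b) the necessity
audit: with α algebraic, B := 0 and the pencil of degree-e hypersurfaces through a generic
projection X' must satisfy every clause (general member smooth, total space flat over A¹ minus the
other critical values, X → X' an isomorphism over the smooth locus of X') — if not, the crux is
mis-typed; (c) LE(2) (k = 1) must be PROVABLE outright from Lefschetz (1,1)
(lefschetzOneOne_rational) by (b); (d) first real test = the K1 computation for one explicit (X⁴,
α).
TWO-LAYER PLAN. Foreseen glued splits: LimitExtensionMid ⇐ [LE for classes orthogonal to N¹
(primitive, transcendental part)] → [closure of Hodge loci of the universal hypersurface family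
meets every generic-projection stratum] → LimitExtensionMid; HypersurfaceHodge ⇐
FiniteTreeOfFlavours' MovableClassesAlgebraic → RigidQbarClassesAlgebraic (+RigidImpliesQbar) →
HypersurfaceHodge (their assembly). Depth ≤ 1, k ≤ 3.
SUPPORT. SpecialisationOfAlgebraicity (the pull-back lemma, theorem-level classical topology of
algebraic families; no Hodge theory), MiddleDivisorSupport (verbatim = NodalSupport's crux; here the
OUTPUT of LE ∧ HChyp via PullbackGlue), MiddleDivisorSupportSuffices (NodalSupport's chain:
stmt-HodgeConjecture-1082..1085), HypersurfacesSufficeOfLE (= models → LE →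
FiniteTreeOfFlavours.HypersurfacesSuffice verbatim), HodgeFourfolds, HypersurfaceHodgeFourLowDegree
(Zucker d = 3, Conte–Murre d = 4, 5; d ≤ 2 cellular), Assembly (propositional from PullbackGlue +
MiddleDivisorSupportSuffices; Sketch.lean `example`).
NUMBERS. dim PGL(6) = 35; dim |O_{P^5}(6)| = 461; h^{3,1}(sextic fourfold) = 426
(FiniteTreeOfFlavours); HC for hypersurface fourfolds known for d ≤ 5; level ≥ 3 ⟺ h^{2k,0} ≠ 0 or
h^{p,q} ≠ 0 with p − q ≥ 3 (hypersurface 2k-folds of degree ≥ 2k + 2).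
SOURCES. Thomas2005Nodes (Prop. 2, §4), DecataldoMigliorini2009 (§4: Fact 4.1, Lemma 4.2, Prop. 4.5;
arXiv:0711.1307 READ this session), GreenGriffiths2007Singularities, BrosnanFangNiePearlstein2009,
DeligneHodgeII1971 (4.1.1 fixed part), DeligneHodgeIII1974 (8.2.8), Steenbrink1976,
CattaniDeligneKaplan1995JAMS, BaldiKlinglerUllmo2024, GriffithsHarris1985, CilibertoLopez1991,
Otwinowska2002, PeskineSzpiro1974, KollarVoisin2024 (smoothability below the middle dimension;
arXiv:2311.04714 READ), Fulton1998, VoisinHodgeI2002, VoisinHodgeII2003, Zucker1977CubicFourfolds,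
ConteMurre1978, Shioda1979HodgeFermat, Deligne2000, Jannsen1990MixedMotives.
DEFINITION REQUESTS. None load-bearing (all items typed over existing declarations). Wanted for the
sharp (infinitesimal) LE: the specialisation map / nearby-cycle comparison H^*(W_{t₀}(ℂ)) →
H^*(W_t(ℂ)) of a proper family over a complex curve with its compatibility with fundamental classes
of flat cycles (Fulton1998 §20.3), and a limit-mixed-Hodge-structure interface (Steenbrink1976) —
filed as a definition request against #2.

Novelty: Searches run 2026-08-15 (this session): zbMATH 'smoothing algebraic cycles rational coefficients' (→
KollarVoisin2024 = arXiv:2311.04714 READ abstract; Benoist–Voisin arXiv:2405.12620; Hironaka 1968),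
'Noether-Lefschetz degeneration reducible surfaces' (→ Brevik–Nollet 2020 only), 'Hodge classes
degenerations' (→ DecataldoMigliorini2009 = arXiv:0711.1307 READ in full §4; Mounda arXiv:2507.15012
(degenerates X itself; audit: low content); Mustafin 1986 invariant cycles; Green–Griffiths PAMQ
2023), 'Hodge conjecture hypersurfaces suffices reduction' / 'Hodge conjecture degeneration limit
algebraic cycles specialization' (0 hits); crossref title search Griffiths–Harris NL (→
GriffithsHarris1985 doi:10.1007/bf01455794, Wu 1990, Dan 2015, Voisin 1989, O'Grady 2016); local
hybrid 'it suffices to prove the Hodge conjecture for complete intersections degeneration component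
special fibre' (textbook pages only: Voisin II, Green–Murre–Voisin CIME, Cattani–El Zein–Griffiths
notes); lit galaxy search --star all 'complete intersections containing a given variety Hodge' /
'limit of Hodge classes' / 'degenerations of complete intersections' (0 rows), --star pdf
'Noether-Lefschetz locus' (Green JDG components of maximal dimension; Lopez–Maclean explicit NL for
threefolds); the card's audit (refuter-7-0) had run zbMATH 'Hodge conjecture linkage', crossref
'Hodge conjecture smooth complete intersection suffices general varieties' (only Mansour SSRN
doi:10.2139/ssrn.5618090 — unrefereed, unasses  [refs: 10.1007/bf01455794, 10.2139/ssrn.5618090, 2311.04714, 2405.12620, 0711.1307, 2507.15012, doi:10.1007/bf01455794, doi:10.2139/ssrn.5618090, KollarVoisin2024, DecataldoMigliorini2009, GriffithsHarris1985, BrosnanFangNiePearlstein2009, CilibertoLopez1991]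

Barriers (technique_class: degeneration, hodge-locus-boundary, coniveau): - technique_class: degeneration, hodge-locus-boundary, coniveau, lefschetz-pencil
-
Literature.Barriers.HodgeConjecture.Bloch1990_cohomologicalHodgeConjecture_singular_counterexample:
evaded — the singular special fibre W_{t₀} and the singular image X' are used only through singular
(co)homology of complex points, fundamental classes, Mayer–Vietoris and the relative homeomorphism
of the normalisation-type map g (Jannsen's homological formulation); no Chern classes, K₀ or 'Hodge
classes' OF a singular variety are ever asserted algebraic; every conclusion is a statement on the
smooth X (supportedClasses X) or on smooth fibres.
-
Literature.Barriers.HodgeConjecture.BarbieriVialeSrinivas1994_singularLefschetzOneOne_counterexample: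
same evasion; Lefschetz (1,1) is invoked only on smooth X, smooth fibres and resolutions D̃.
- Literature.Barriers.HodgeConjecture.Voisin2003_generalHypersurface_noIntegralClassInF: evaded —
rational coefficients throughout (IsRationalClass, ℂ-spans), and the one-parameter family is a
degeneration of AMBIENT hypersurfaces, not a pencil of sections of X; no Abel–Jacobi map or Jacobi
inversion is used (the cycles come from HC on the smooth fibres + relative Hilbert schemes, as in
NodalSupport's PencilReduction).
- Literature.Barriers.HodgeConjecture.CattaniDeligneKaplan1995_hodgeLocus_algebraicFor: not an
obstruction but the engine: the curve T of LE lies in the closure of an algebraic Hodge-locus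
component of the universal hypersurface family; the bet is

Novelty grade: new-combination — ROUTE REVIEW (refuter rreview-…-e48716e3; gen 0 stamped all 12 items 13:47–13:50Z, gen 2 re-checked 14:30Z; full text = evidence REVIEW-LimitExtension.md on the route and on stmt-3004). KEEP OPEN, SOUND. 12/12 decls rc0; compiled: Assembly ⟸ PullbackGlue+MDSSuffices, Assembly m a b : HodgeConjecture (refuter refuter-rreview-route-HodgeConjecture-Li-e48716e3-g2-0, 2026-08-15T14:32:33Z; prior: GriffithsHarris1985 doi:10.1007/bf01455794 (NL components by degeneration, k=1 template); CilibertoLopez1991, Thomas2005Nodes doi:10.1090/s1056-3911-04-00378-9 Thm 1/Prop 2; DecataldoMigliorini2009 arXiv:0711.1307 §4, Jannsen1990MixedMotives Thm 7.9 (homological HC ⟺ HC), KollarVoisin2024 arXiv:2311.04714; BaldiKlinglerUllmo2024 (why-might-fail), route FiniteTreeOfFlavours support 1496 Hypersurfac)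

History (route lifecycle, newest last):
- 2026-08-15T16:26:52Z · rev 1: restated MiddleDivisorSupportSuffices (stmt-HodgeConjecture-3000), HodgeFourfolds (stmt-HodgeConjecture-3002), HypersurfacesSufficeOfLE (stmt-HodgeConjecture-3001), Assembly (stmt-HodgeConjecture-3004) — route-repair (rbadge g2) step 1/2 — reroute around the one unproved cone fact Literature.AlgebraicGeometry.Ho (planner-rbadge-HodgeConjecture-LimitExtension-85272f30-g2-0)
- 2026-08-26T16:57:20Z · DORMANT — reconciler: no traction for 5.5 d (last activity item-evidence-added at 2026-08-21T05:23:42Z); parked, not closed — `ledger route dormant route-HodgeConjecture- (operator:999:3167619)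

sub-problem: HodgeConjecture · status: dormant · opened planner-plancard-HodgeConjecture-HodgeConject-0a30103c-0 2026-08-15T11:09:52Z · rev 3 · ledger route-HodgeConjecture-LimitExtension
GENERATED by the gate from the ledger (D-0016/17). Provers cite these decls: `theorem foo : Summit.HodgeConjecture.HodgeConjecture.Theses.LimitExtension.<Decl> := …` in Summits/HodgeConjecture/HodgeConjecture/Theorems/<Name>.lean.
-/

namespace Summit.HodgeConjecture.HodgeConjecture.Theses.LimitExtension

open scoped BigOperators Topology Manifold Classical MeasureTheory ProbabilityTheory Matrix InnerProductSpace ComplexConjugate ContinuousMap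
open Filter Set Function TopologicalSpace MeasureTheory

attribute [summit_statement] _root_.HodgeConjecture

/-- item stmt-HodgeConjecture-2995 · crux · rank 2 · open · by planner
why it might fail: For a general curve through [X'] invariants are Qh^k: T must sit in a Hodge-locus component whose closure meets a boundary point of EVERY X; in level >= 3 these are atypical and finitely many per degree (BKU 2024), so only the free degree can save universality.
sources: CattaniDeligneKaplan1995JAMS, BaldiKlinglerUllmo2024, GriffithsHarris1985, CilibertoLopez1991, Steenbrink1976, DeligneHodgeII1971
[crux] Limit extension, middle degree (the mechanism of card
liaison-limit-extension-ci-universality, global form): for X smooth projective of dimension 2k (k ≥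
1) and α a rational (k,k)-class in H^{2k}(X(ℂ);ℂ) there exist a smooth irreducible complex curve T,
t₀ ∈ T(ℂ), a flat proper f : W → T, a morphism g : X → W_{t₀} restricting to an open immersion on
some nonempty open U ⊆ X (X birational to an irreducible component of the special fibre; intended
W_{t₀} ⊇ a generic projection X' ⊂ P^{2k+1} of X, or a broken complete intersection linked to X),
and a rational class B ∈ H^{2k}(W(ℂ);ℂ) such that for every t ≠ t₀ the fibre W_t is a smooth
hypersurface of dimension 2k (some degree) on which B is of type (k,k), and α − (g ≫ ι_{t₀})^*B ∈
supportedClasses X (2k) 1 = N¹H^{2k}. NECESSARY for HC (B = 0, pencil through X'). Attack: Hodge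
loci of the universal hypersurface family near the boundary point [X'] (CDK analysis at infinity,
IVHS/Jacobian ring of the limit, KNU log period maps); k = 1 is the Griffiths–Harris/Ciliberto–Lopez
NL-by-degeneration technology. [deps: none] [difficulty: open-problem] -/
@[route_item "route-HodgeConjecture-LimitExtension", crux]
def LimitExtensionMid : Prop :=
  ∀ ⦃k : ℕ⦄ ⦃X : Literature.AlgebraicGeometry.Motives.SchemeOver ℂ⦄, 0 < k → Literature.AlgebraicGeometry.Motives.IsSmoothProjective (2 * k) X → ∀ α : Literature.AlgebraicGeometry.HodgeTheory.complexBetti X (2 * k), Literature.AlgebraicGeometry.HodgeTheory.IsRationalClass α → Literature.AlgebraicGeometry.HodgeTheory.IsOfHodgeType (2 * k) X (2 * k) k k α → ∃ (T W : Literature.AlgebraicGeometry.Motives.SchemeOver ℂ) (f : W ⟶ T) (t₀ : Literature.AlgebraicGeometry.Motives.ComplexPoints T) (g : X ⟶ Literature.AlgebraicGeometry.Motives.fiberOver f t₀) (B : Literature.AlgebraicGeometry.HodgeTheory.complexBetti W (2 * k)), AlgebraicGeometry.SmoothOfRelativeDimension 1 T.hom ∧ IrreducibleSpace T.left ∧ AlgebraicGeometry.Flat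 f.left ∧ AlgebraicGeometry.IsProper f.left ∧ (∃ U : X.left.Opens, (U : Set X.left).Nonempty ∧ AlgebraicGeometry.IsOpenImmersion (CategoryTheory.CategoryStruct.comp U.ι g.left)) ∧ Literature.AlgebraicGeometry.HodgeTheory.IsRationalClass B ∧ (∀ t : Literature.AlgebraicGeometry.Motives.ComplexPoints T, t ≠ t₀ → (∃ d : ℕ, Literature.AlgebraicGeometry.Motives.IsSmoothHypersurface (2 * k) d (Literature.AlgebraicGeometry.Motives.fiberOver f t)) ∧ Literature.AlgebraicGeometry.HodgeTheory.IsOfHodgeType (2 * k) (Literature.AlgebraicGeometry.Motives.fiberOver f t) (2 * k) k k (Literature.AlgebraicGeometry.HodgeTheory.complexBetti.map (Literature.AlgebraicGeometry.Motives.fiberι f t) (2 * k) B)) ∧ α - Literature.AlgebraicGeometry.HodgeTheory.complexBetti.map (CategoryTheory.CategoryStruct.comp g (Literature.AlgebraicGeometry.Motives.fiberι f t₀)) (2 * k) B ∈ Literature.AlgebraicGeometry.HodgeTheory.supportedClasses X (2 * k) 1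

/-- item stmt-HodgeConjecture-1491 · crux · rank 3 · open · by planner
why it might fail: It is HC restricted to the one family with big monodromy; open from the sextic fourfold on (level >= 3, h^{4,0} != 0), where no cycle supply is known and BKU only gives finiteness of movable families.
sources: Deligne2000, Zucker1977CubicFourfolds, ConteMurre1978, Shioda1979HodgeFermat, BaldiKlinglerUllmo2024
[target] Thesis X: the Hodge conjecture (Hodge model + every rational (k,k)-class in H^{2k}(X(C);C)
lies in N^k = algebraicClasses) for every smooth hypersurface X in P^{n+1}_C of every dimension n
and degree d. Follows from MovableClassesAlgebraic + RigidImpliesQbar + RigidQbarClassesAlgebraic +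
the Literature fact nonempty_hodgeModel by the tautological movable/rigid case split (evidence:
Sketch2.lean target_holds, rc 0). Classical sub-cases: d <= 2, n <= 3 (Lefschetz (1,1) + hard
Lefschetz), (4,3) Zucker1977CubicFourfolds, (4,4),(4,5) ConteMurre1978, Fermat m prime or <= 20
Shioda1979HodgeFermat; the BKU finite-tree regime is n >= 3, d >= 6 (BaldiKlinglerUllmo2024 Cor
2.7). -/
@[route_item "route-HodgeConjecture-LimitExtension", crux]
def HypersurfaceHodge : Prop :=
  ∀ ⦃n d : ℕ⦄ ⦃X : Literature.AlgebraicGeometry.Motives.SchemeOver ℂ⦄, Literature.AlgebraicGeometry.Motives.IsSmoothHypersurface n d X → Literature.AlgebraicGeometry.HodgeTheory.HodgeConjectureFor n X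

/-- item stmt-HodgeConjecture-2996 · crux · rank 4 · open · by planner
why it might fail: Same as LimitExtensionMid at k = 2: the Hodge loci of degree-e hypersurface fourfolds (finitely many atypical positive-dimensional families for e >= 6) may all miss the generic-projection boundary points of some fourfold X for every bounded e.
sources: GriffithsHarris1985, CilibertoLopez1991, Otwinowska2002, BaldiKlinglerUllmo2024
[crux] Calibration at the first open dimension: LimitExtensionMid for k = 2 (smooth projective
fourfolds, rational (2,2)-classes, fibres smooth hypersurface fourfolds in P^5). With
HypersurfaceHodgeFour it yields HC for ALL smooth projective fourfolds (support HodgeFourfolds). The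
k = 2 instance is where the boundary IVHS computation is feasible: H^4 of a degree-e hypersurface
fourfold has an explicit Jacobian-ring description and its NL/Hodge loci are the best studied
(Otwinowska2002, FiniteTreeOfFlavours' sextic testbed). First honest test: X = S × S' with S, S'
surfaces of general type carrying a rational Hodge isometry of transcendental lattices (HC open),
projected to P^5. [deps: LimitExtensionMid (instance)] [difficulty: XL] -/
@[route_item "route-HodgeConjecture-LimitExtension", crux]
def LimitExtensionFour : Prop :=
  ∀ ⦃X : Literature.AlgebraicGeometry.Motives.SchemeOver ℂ⦄, Literature.AlgebraicGeometry.Motives.IsSmoothProjective 4 X → ∀ α : Literature.AlgebraicGeometry.HodgeTheory.complexBetti X 4, Literature.AlgebraicGeometry.HodgeTheory.IsRationalClass α → Literature.AlgebraicGeometry.HodgeTheory.IsOfHodgeType 4 X 4 2 2 α → ∃ (T W : Literature.AlgebraicGeometry.Motives.SchemeOver ℂ) (f : W ⟶ T) (t₀ : Literature.AlgebraicGeometry.Motives.ComplexPoints T) (g : X ⟶ Literature.AlgebraicGeometry.Motives.fiberOver f t₀) (B : Literature.AlgebraicGeometry.HodgeTheory.complexBetti W 4), AlgebraicGeometry.SmoothOfRelativeDimension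 1 T.hom ∧ IrreducibleSpace T.left ∧ AlgebraicGeometry.Flat f.left ∧ AlgebraicGeometry.IsProper f.left ∧ (∃ U : X.left.Opens, (U : Set X.left).Nonempty ∧ AlgebraicGeometry.IsOpenImmersion (CategoryTheory.CategoryStruct.comp U.ι g.left)) ∧ Literature.AlgebraicGeometry.HodgeTheory.IsRationalClass B ∧ (∀ t : Literature.AlgebraicGeometry.Motives.ComplexPoints T, t ≠ t₀ → (∃ d : ℕ, Literature.AlgebraicGeometry.Motives.IsSmoothHypersurface 4 d (Literature.AlgebraicGeometry.Motives.fiberOver f t)) ∧ Literature.AlgebraicGeometry.HodgeTheory.IsOfHodgeType 4 (Literature.AlgebraicGeometry.Motives.fiberOver f t) 4 2 2 (Literature.AlgebraicGeometry.HodgeTheory.complexBetti.map (Literature.AlgebraicGeometry.Motives.fiberι f t) 4 B)) ∧ α - Literature.AlgebraicGeometry.HodgeTheory.complexBetti.map (CategoryTheory.CategoryStruct.comp g (Literature.AlgebraicGeometry.Motives.fiberι f t₀)) 4 B ∈ Literature.AlgebraicGeometry.HodgeTheory.supportedClasses X 4 1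

/-- item stmt-HodgeConjecture-2997 · crux · rank 5 · open · by planner
why it might fail: Open for every degree >= 6; a positive-dimensional Hodge-locus component of U_{4,6} not explained by surface classes (FiniteTreeOfFlavours K1) would be an HC counterexample family.
sources: ConteMurre1978, Zucker1977CubicFourfolds, BaldiKlinglerUllmo2024, Otwinowska2002
[crux] The Hodge conjecture for smooth hypersurface FOURFOLDS X ⊂ P^5 of every degree d (instance of
HypersurfaceHodge; partner of LimitExtensionFour in HodgeFourfolds). Known for d ≤ 5 (support
HypersurfaceHodgeFourLowDegree: d ≤ 2 cellular, d = 3 Zucker1977CubicFourfolds, d = 4, 5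
ConteMurre1978; Fano ⇒ CH₀ = ℤ ⇒ Bloch–Srinivas degree 4); OPEN for d ≥ 6 (h^{4,0} ≠ 0): the sextic
is FiniteTreeOfFlavours' MovableClassesAlgebraicSextic testbed (movable classes) plus rigid classes.
[deps: none] [difficulty: open-problem] -/
@[route_item "route-HodgeConjecture-LimitExtension", crux]
def HypersurfaceHodgeFour : Prop :=
  ∀ ⦃d : ℕ⦄ ⦃X : Literature.AlgebraicGeometry.Motives.SchemeOver ℂ⦄, Literature.AlgebraicGeometry.Motives.IsSmoothHypersurface 4 d X → Literature.AlgebraicGeometry.HodgeTheory.HodgeConjectureFor 4 X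

/-- item stmt-HodgeConjecture-1083 · crux · rank 6 · closed · proved by Summit.HodgeConjecture.HodgeConjecture.Theorems.linearSystemTorelli_pencilReduction_proof @ df9bbf4b207d (prover) · by planner
why it might fail: HC-implied, so only provability can fail: the printed proofs are half-page sketches; the spread cycle must match u^*c on EVERY smooth fibre (Baire: uncountably many) and the residue on singular fibres / base locus needs HC(m) on resolutions (a gap in Thomas's text); no pencil carriers in tree.
sources: Thomas2005Nodes, DecataldoMigliorini2009, arXiv:0711.1307, arXiv:math/0212216, KerrPearlstein2011, VoisinHodgeII2003
[support] Lefschetz-pencil reduction below the middle (theorem in print, Thomas2005Nodes Prop. 2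
'presumably standard'; KerrPearlstein2011 §3.1; Shioda1983WhatIsKnown): for 2 ≤ 2p ≤ m and X smooth
projective of dimension m+1, HC in ALL codimensions for smooth projective m-folds (the hyperplane
sections) plus HC in codimension p−1 for (m+1)-folds imply HC in codimension p for X. Proof:
Lefschetz pencil 𝒳̃ = Bl_B X → ℙ¹; H^{2p}(X) ↪ H^{2p}(Y_t) (weak Lefschetz); HC on each smooth Y_t
gives cycles, the relative Hilbert scheme + countability give an algebraic family of cycles over a
finite cover of ℙ¹ (Thomas/Schoen argument); d·π^*c − [𝒵̄] vanishes on smooth fibres hence (weights: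
W_{2p} of the smooth part; H²(U) = 0 for U affine) is supported on the singular fibres, a divisor,
so DivisorInduction-type Gysin + HC(p−1) finish; π_* returns to X. -/
@[route_item "route-HodgeConjecture-LimitExtension", crux]
def PencilReduction : Prop :=
  ∀ (m p : ℕ), 1 ≤ p → 2 * p ≤ m → (∀ ⦃Y : Literature.AlgebraicGeometry.Motives.SchemeOver ℂ⦄, Literature.AlgebraicGeometry.Motives.IsSmoothProjective m Y → ∀ (q : ℕ) (c : Literature.AlgebraicGeometry.HodgeTheory.complexBetti Y (2 * q)), Literature.AlgebraicGeometry.HodgeTheory.IsRationalClass c → Literature.AlgebraicGeometry.HodgeTheory.IsOfHodgeType m Y (2 * q) q q c → c ∈ Literature.AlgebraicGeometry.HodgeTheory.algebraicClasses Y q) → (∀ ⦃X' : Literature.AlgebraicGeometry.Motives.SchemeOver ℂ⦄, Literature.AlgebraicGeometry.Motives.IsSmoothProjective (m + 1) X' → ∀ c : Literature.AlgebraicGeometry.HodgeTheory.complexBetti X' (2 * (p - 1)), Literature.AlgebraicGeometry.HodgeTheory.IsRationalClass c → Literature.AlgebraicGeometry.HodgeTheory.IsOfHodgeType (m + 1)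 X' (2 * (p - 1)) (p - 1) (p - 1) c → c ∈ Literature.AlgebraicGeometry.HodgeTheory.algebraicClasses X' (p - 1)) → ∀ ⦃X : Literature.AlgebraicGeometry.Motives.SchemeOver ℂ⦄, Literature.AlgebraicGeometry.Motives.IsSmoothProjective (m + 1) X → ∀ c : Literature.AlgebraicGeometry.HodgeTheory.complexBetti X (2 * p), Literature.AlgebraicGeometry.HodgeTheory.IsRationalClass c → Literature.AlgebraicGeometry.HodgeTheory.IsOfHodgeType (m + 1) X (2 * p) p p c → c ∈ Literature.AlgebraicGeometry.HodgeTheory.algebraicClasses X p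

/-- `PencilReduction` holds: proved by `Summit.HodgeConjecture.HodgeConjecture.Theorems.linearSystemTorelli_pencilReduction_proof` @ df9bbf4b207d. -/
theorem PencilReduction_holds : PencilReduction := _root_.Summit.HodgeConjecture.HodgeConjecture.Theorems.linearSystemTorelli_pencilReduction_proof

/-- item stmt-HodgeConjecture-1081 · support · rank 9 · open · by planner
sources: Thomas2005Nodes, DecataldoMigliorini2009
[crux] Every rational (p,p) class in the MIDDLE degree of a smooth projective variety of even
dimension 2p (p ≥ 1) is supported on a divisor: c ∈ supportedClasses X (2p) 1 = N¹H^{2p} (vanishes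
on the complement of some Zariski-closed proper subset). Sharp printed form (Thomas2005Nodes Thm 1,
READ pp.1–4): supported on a NODAL hypersurface section D ∈ |O_X(N)| for some N (PD c ∈ im
H_{2p}(D;ℚ)) — EQUIVALENT to the Hodge conjecture; equivalently the admissible normal function of c
on |O_X(N)|, N ≫ 0, has a singularity (GreenGriffiths2007Singularities;
BrosnanFangNiePearlstein2009; KerrPearlstein2011 Conj. 41/Thm 42). Known for p = 1 (Lefschetz
(1,1)), for X with CH₀ supported in dimension ≤ … (decomposition of the diagonal), cubic fourfolds
(Zucker1977). Attach point for thimble-lattice certificates on fourfolds (card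
thimble-lattice-nodal-certificates) and for Thomas's symplectic suggestion (Donaldson pencils /
Auroux–Muñoz–Presas). -/
@[route_item "route-HodgeConjecture-LimitExtension", crux]
def MiddleDivisorSupport : Prop :=
  ∀ ⦃p : ℕ⦄ ⦃X : Literature.AlgebraicGeometry.Motives.SchemeOver ℂ⦄, 1 ≤ p → Literature.AlgebraicGeometry.Motives.IsSmoothProjective (2 * p) X → ∀ c : Literature.AlgebraicGeometry.HodgeTheory.complexBetti X (2 * p), Literature.AlgebraicGeometry.HodgeTheory.IsRationalClass c → Literature.AlgebraicGeometry.HodgeTheory.IsOfHodgeType (2 * p) X (2 * p) p p c → c ∈ Literature.AlgebraicGeometry.HodgeTheory.supportedClasses X (2 * p) 1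

/-- item stmt-HodgeConjecture-1082 · support · rank 9 · closed · proved by Summit.HodgeConjecture.HodgeConjecture.Theorems.nodalSupport_divisorInduction_proof @ 3fc7f6c6a7c9 (prover) · by planner
sources: DeligneHodgeIII1974, VoisinHodgeII2003, Thomas2005Nodes, Voisin2025
[support] Divisor induction (theorem in print): if HC holds in codimension p−1 for smooth projective
n-folds, then on a smooth projective (n+1)-fold every rational (p,p) class supported on a divisor is
algebraic. Proof: enlarge the support to a divisor D; ker(H^{2p}(X) → H^{2p}(X∖D)) = Gysin image of
H^{2p−2}(D̃)(−1) for a resolution D̃ → D (Deligne, Hodge III Cor. 8.2.8); the Gysin map is a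
morphism of polarisable Hodge structures, so by semisimplicity a Hodge class in the image lifts to a
Hodge class on D̃ (componentwise, D̃ = ⊔ D̃_j smooth projective of dim n); HC(D̃_j, p−1) and
'push-forward of algebraic is algebraic' conclude. Needs Hironaka + cycle class/Gysin on the tree's
carriers. -/
@[route_item "route-HodgeConjecture-LimitExtension"]
def DivisorInduction : Prop :=
  ∀ (n p : ℕ), 1 ≤ p → (∀ ⦃Y : Literature.AlgebraicGeometry.Motives.SchemeOver ℂ⦄, Literature.AlgebraicGeometry.Motives.IsSmoothProjective n Y → ∀ c : Literature.AlgebraicGeometry.HodgeTheory.complexBetti Y (2 * (p - 1)), Literature.AlgebraicGeometry.HodgeTheory.IsRationalClass c → Literature.AlgebraicGeometry.HodgeTheory.IsOfHodgeType n Y (2 * (p - 1)) (p - 1) (p - 1) c → c ∈ Literature.AlgebraicGeometry.HodgeTheory.algebraicClasses Y (p - 1)) → ∀ ⦃X : Literature.AlgebraicGeometry.Motives.SchemeOver ℂ⦄, Literature.AlgebraicGeometry.Motives.IsSmoothProjective (n + 1) X → ∀ c : Literature.AlgebraicGeometry.HodgeTheory.complexBetti X (2 * p), Literature.AlgebraicGeometry.HodgeTheory.IsRationalClass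 c → Literature.AlgebraicGeometry.HodgeTheory.IsOfHodgeType (n + 1) X (2 * p) p p c → c ∈ Literature.AlgebraicGeometry.HodgeTheory.supportedClasses X (2 * p) 1 → c ∈ Literature.AlgebraicGeometry.HodgeTheory.algebraicClasses X p

-- `DivisorInduction` holds: proved by `Summit.HodgeConjecture.HodgeConjecture.Theorems.nodalSupport_divisorInduction_proof` @ 3fc7f6c6a7c9 (its module imports this route file, so no `_holds` link can be stated here).

-- earlier MiddleDivisorSupportSuffices (stmt-HodgeConjecture-3000, replaced 2026-08-15T16:26:52Z -> stmt-HodgeConjecture-10865): retired by None — (∀ (n : ℕ) (X : Literature.AlgebraicGeometry.Motives.SchemeOver ℂ), Literature.AlgebraicGeometry.HodgeTheory.nonempty_hodgeModel n X) → MiddleDivisorSupport → HodgeConjecture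
/-- item stmt-HodgeConjecture-10865 · support · rank 9 · closed · proved by Summit.HodgeConjecture.HodgeConjecture.Theorems.limitExtension_middleDivisorSupportSuffices_proof @ 37dfad46ec2e (prover) · by planner
sources: Thomas2005Nodes, DecataldoMigliorini2009, DeligneHodgeIII1974, VoisinHodgeI2002, VoisinHodgeII2003
[support] Glue 2 (theorem in print): with Hodge models — antecedent = the route's support item
HodgeModels written inline (∀ n X smooth projective, Nonempty (HodgeModel n X); 2026-08-15
route-repair: replaces the definitionally equal named-fact spelling `∀ n X, nonempty_hodgeModel n
X`, so that no unproved Literature constant sits in the route's constant cone) —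
MiddleDivisorSupport ⟹ HodgeConjecture, by strong induction on the dimension and inner induction on
the codimension: degree above the middle by hard Lefschetz / hyperplane sections, below the middle
by Lefschetz pencils + relative Hilbert schemes + HC one dimension down (Thomas2005Nodes Prop. 2;
DecataldoMigliorini2009 §4 Prop. 4.5), the middle by MiddleDivisorSupport + Deligne Hodge III 8.2.8
+ semisimplicity + HC one dimension down in codimension p−1 (supplied by the pencil step — no
circularity). Exactly the assembly chain of route NodalSupport: provable from its typed supports
DivisorInduction, PencilReduction, HardLefschetzReduction (stmt-HodgeConjecture-1082/1083/1084) by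
their Assembly logic (stmt-HodgeConjecture-1085). [deps: MiddleDivisorSupport, HodgeModels]
[difficulty: XL as Lean, folklore as math] -/
@[route_item "route-HodgeConjecture-LimitExtension", crux]
def MiddleDivisorSupportSuffices : Prop :=
  (∀ ⦃n : ℕ⦄ ⦃X : Literature.AlgebraicGeometry.Motives.SchemeOver ℂ⦄, Literature.AlgebraicGeometry.Motives.IsSmoothProjective n X → Nonempty (Literature.AlgebraicGeometry.HodgeTheory.HodgeModel n X)) → MiddleDivisorSupport → HodgeConjecture

-- `MiddleDivisorSupportSuffices` holds: proved by `Summit.HodgeConjecture.HodgeConjecture.Theorems.limitExtension_middleDivisorSupportSuffices_proof` @ 37dfad46ec2e (its module imports this route file, so no `_holds` link can be stated here).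

-- earlier HodgeFourfolds (stmt-HodgeConjecture-3002, replaced 2026-08-15T16:26:52Z -> stmt-HodgeConjecture-10866): retired by None — (∀ (n : ℕ) (X : Literature.AlgebraicGeometry.Motives.SchemeOver ℂ), Literature.AlgebraicGeometry.HodgeTheory.nonempty_hodgeModel n X) → LimitExtensionFour → HypersurfaceHodgeFour → ∀ ⦃X : Literature.AlgebraicGeometry.Motives.SchemeOver ℂ⦄, Literature.AlgebraicGeometry.
/-- item stmt-HodgeConjecture-10866 · support · rank 9 · open · by planner
sources: Thomas2005Nodes, Murre1977, VoisinHodgeII2003, DeligneHodgeIII1974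
[support] Fourfold milestone: HodgeModels (inline: ∀ n X smooth projective, Nonempty (HodgeModel n
X); 2026-08-15 route-repair) → LimitExtensionFour → HypersurfaceHodgeFour → HC for ALL smooth
projective fourfolds. Proof: SpecialisationOfAlgebraicity (k = 2) gives MiddleDivisorSupport for
fourfolds; degree 4 then by NodalSupport.DivisorInduction (n = 3, p = 2) from Lefschetz (1,1) on the
resolved divisor (fact lefschetzOneOne_rational); degree 2 Lefschetz (1,1); degree 6 hard Lefschetz
from degree 2 (HardLefschetzReduction; '(3,3) on fourfolds', Murre1977); degrees 0, 8 in tree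
(algebraicClasses_zero, TopDegreeClasses). First dimension where HC is open; everything except the
two cruxes is classical. [deps: LimitExtensionFour, HypersurfaceHodgeFour,
SpecialisationOfAlgebraicity, HodgeModels] [difficulty: L] -/
@[route_item "route-HodgeConjecture-LimitExtension", crux]
def HodgeFourfolds : Prop :=
  (∀ ⦃n : ℕ⦄ ⦃X : Literature.AlgebraicGeometry.Motives.SchemeOver ℂ⦄, Literature.AlgebraicGeometry.Motives.IsSmoothProjective n X → Nonempty (Literature.AlgebraicGeometry.HodgeTheory.HodgeModel n X)) → LimitExtensionFour → HypersurfaceHodgeFour → ∀ ⦃X : Literature.AlgebraicGeometry.Motives.SchemeOver ℂ⦄, Literature.AlgebraicGeometry.Motives.IsSmoothProjective 4 X → Literature.AlgebraicGeometry.HodgeTheory.HodgeConjectureFor 4 X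

-- earlier HypersurfacesSufficeOfLE (stmt-HodgeConjecture-3001, replaced 2026-08-15T16:26:52Z -> stmt-HodgeConjecture-10867): retired by None — LimitExtensionMid → (∀ ⦃n d : ℕ⦄ ⦃X : Literature.AlgebraicGeometry.Motives.SchemeOver ℂ⦄, Literature.AlgebraicGeometry.Motives.IsSmoothHypersurface n d X → ∀ (k : ℕ) (c : Literature.AlgebraicGeometry.HodgeTheory.complexBetti X (2 * k)), Literature.AlgebraicGe
/-- item stmt-HodgeConjecture-10867 · support · rank 9 · open · by planner
sources: Thomas2005Nodes, BaldiKlinglerUllmo2024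
[support] The bridge route FiniteTreeOfFlavours declares OPEN with no mechanism (its support
HypersurfacesSuffice, 'cycle part of HC for smooth hypersurfaces ⇒ cycle part of HC for all smooth
projective varieties'): here = HodgeModels (inline: ∀ n X smooth projective, Nonempty (HodgeModel n
X)) → LimitExtensionMid → [FiniteTreeOfFlavours.HypersurfacesSuffice, verbatim] (2026-08-15
route-repair: the models antecedent announced here was missing from the rev-0 signature — refuter
rreview e48716e3 non-blocking note — and is now added; without it the cycle-part chain cannot use
IsOfHodgeType / Deligne Hodge III 8.2.8). Proof: PullbackGlue restricted to cycle parts +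
MiddleDivisorSupportSuffices. Links the two routes: a proof of LimitExtensionMid turns
FiniteTreeOfFlavours' target into the summit. [deps: PullbackGlue, MiddleDivisorSupportSuffices,
HodgeModels] [difficulty: S given deps] -/
@[route_item "route-HodgeConjecture-LimitExtension", crux]
def HypersurfacesSufficeOfLE : Prop :=
  (∀ ⦃n : ℕ⦄ ⦃X : Literature.AlgebraicGeometry.Motives.SchemeOver ℂ⦄, Literature.AlgebraicGeometry.Motives.IsSmoothProjective n X → Nonempty (Literature.AlgebraicGeometry.HodgeTheory.HodgeModel n X)) → LimitExtensionMid → (∀ ⦃n d : ℕ⦄ ⦃X : Literature.AlgebraicGeometry.Motives.SchemeOver ℂ⦄, Literature.AlgebraicGeometry.Motives.IsSmoothHypersurface n d X → ∀ (k : ℕ) (c : Literature.AlgebraicGeometry.HodgeTheory.complexBetti X (2 * k)), Literature.AlgebraicGeometry.HodgeTheory.IsRationalClass c → Literature.AlgebraicGeometry.HodgeTheory.IsOfHodgeType n X (2 * k) k k c → c ∈ Literature.AlgebraicGeometry.HodgeTheory.algebraicClasses X k) → ∀ ⦃n : ℕ⦄ ⦃X : Literature.AlgebraicGeometry.Motives.SchemeOver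 ℂ⦄, Literature.AlgebraicGeometry.Motives.IsSmoothProjective n X → ∀ (k : ℕ) (c : Literature.AlgebraicGeometry.HodgeTheory.complexBetti X (2 * k)), Literature.AlgebraicGeometry.HodgeTheory.IsRationalClass c → Literature.AlgebraicGeometry.HodgeTheory.IsOfHodgeType n X (2 * k) k k c → c ∈ Literature.AlgebraicGeometry.HodgeTheory.algebraicClasses X k

/-- item stmt-HodgeConjecture-2998 · support · rank 9 · open · by planner
sources: Fulton1998, VoisinHodgeII2003, Thomas2005Nodes
[support] The pull-back (specialisation) lemma, theorem-level and Hodge-free: k ≥ 1, X smooth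
projective of dim 2k, T a smooth irreducible complex curve, f : W → T flat proper, g : X → W_{t₀} an
open immersion on a nonempty open U ⊆ X, B ∈ H^{2k}(W(ℂ);ℂ) such that for all t ≠ t₀ the fibre W_t
is smooth projective of dim 2k and B|_{W_t} ∈ algebraicClasses (ℂ-span of cycle classes) ⟹ (g ≫
ι)^*B ∈ supportedClasses X (2k) 1. Proof: V := closure of g(U) is an irreducible component of the
special fibre and g : X → V is an isomorphism over g(U) (section of a proper map); relative
Hilbert/Chow countability gives, after a finite base change, a flat cycle 𝒵 over T with [𝒵_t] =
PD(B_t); in a tube W_U ≃ W_{t₀} (proper algebraic map: mapping-cylinder structure) fibres of flat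
cycles are homologous and [W_t] ~ [W_{t₀}] = m[V] + Σ m_i[R_i] (m ≥ 1), so B₀ ⌢ [W_{t₀}] = [𝒵₀];
Mayer–Vietoris on V ∪ R and the relative homeomorphism (X, g⁻¹E') → (V, E'), E' := (V∖g(U)) ∪ (V∩R),
put m·g^*B₀ − cl(Z_X) in the image of H_{2k}(g⁻¹E') = ker(H^{2k}(X) → H^{2k}(X ∖ g⁻¹E'))
(Alexander–Lefschetz duality), i.e. in N¹. Sources: Fulton1998 §10.1, §19.1 (cycle classes, Lemma
19.1.1), §20.3 (specialisation); HatcherA -/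
@[route_item "route-HodgeConjecture-LimitExtension", crux]
def SpecialisationOfAlgebraicity : Prop :=
  ∀ ⦃k : ℕ⦄ ⦃X T W : Literature.AlgebraicGeometry.Motives.SchemeOver ℂ⦄ (f : W ⟶ T) (t₀ : Literature.AlgebraicGeometry.Motives.ComplexPoints T) (g : X ⟶ Literature.AlgebraicGeometry.Motives.fiberOver f t₀) (B : Literature.AlgebraicGeometry.HodgeTheory.complexBetti W (2 * k)), 0 < k → Literature.AlgebraicGeometry.Motives.IsSmoothProjective (2 * k) X → AlgebraicGeometry.SmoothOfRelativeDimension 1 T.hom → IrreducibleSpace T.left → AlgebraicGeometry.Flat f.left → AlgebraicGeometry.IsProper f.left → (∃ U : X.left.Opens, (U : Set X.left).Nonempty ∧ AlgebraicGeometry.IsOpenImmersion (CategoryTheory.CategoryStruct.comp U.ι g.left)) → (∀ t : Literature.AlgebraicGeometry.Motives.ComplexPoints T, t ≠ t₀ → Literature.AlgebraicGeometry.Motives.IsSmoothProjective (2 * k) (Literature.AlgebraicGeometry.Motives.fiberOver f t) ∧ Literature.AlgebraicGeometry.HodgeTheory.complexBetti.map (Literature.AlgebraicGeometry.Motives.fiberι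 f t) (2 * k) B ∈ Literature.AlgebraicGeometry.HodgeTheory.algebraicClasses (Literature.AlgebraicGeometry.Motives.fiberOver f t) k) → Literature.AlgebraicGeometry.HodgeTheory.complexBetti.map (CategoryTheory.CategoryStruct.comp g (Literature.AlgebraicGeometry.Motives.fiberι f t₀)) (2 * k) B ∈ Literature.AlgebraicGeometry.HodgeTheory.supportedClasses X (2 * k) 1

/-- item stmt-HodgeConjecture-2999 · support · rank 9 · open · by planner
sources: Thomas2005Nodes
[support] Glue 1 (provable from SpecialisationOfAlgebraicity + 'pull-backs of rational classes are
rational' + N¹ is a submodule): LimitExtensionMid → HypersurfaceHodge → MiddleDivisorSupport. Given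
(X, α), take the LE family; HypersurfaceHodge on each smooth hypersurface fibre W_t makes B|_{W_t}
(rational, type (k,k)) algebraic; SpecialisationOfAlgebraicity gives (g ≫ ι)^*B ∈ N¹; add α − (g ≫
ι)^*B ∈ N¹. Index shift p = k, 1 ≤ p ↔ 0 < k. [deps: SpecialisationOfAlgebraicity] [difficulty: S
given the support] -/
@[route_item "route-HodgeConjecture-LimitExtension", crux]
def PullbackGlue : Prop :=
  LimitExtensionMid → HypersurfaceHodge → MiddleDivisorSupport

/-- item stmt-HodgeConjecture-3003 · support · rank 9 · closed · proved by Summit.HodgeConjecture.HodgeConjecture.Theorems.hypersurfaceHodgeFourLowDegree_proof @ 4bff057e565d (prover) · by planner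
sources: Zucker1977CubicFourfolds, ConteMurre1978, BlochSrinivas1983
[support] Known cases (theorems in print): the Hodge conjecture for smooth hypersurface fourfolds of
degree d ≤ 5 — d = 1 (P^4) and d = 2 (quadric: cellular, all cohomology algebraic), d = 3
Zucker1977CubicFourfolds, d = 4, 5 ConteMurre1978 (fourfolds covered by rational curves;
alternatively Fano ⇒ CH₀ = ℤ (Roitman 1972) ⇒ Bloch–Srinivas degree-4 HC, barrier fact
BlochSrinivas1983_hodgeConjectureDegreeFour_of_chowZeroSupported), plus Lefschetz (1,1), hard
Lefschetz and nonempty_hodgeModel for the other degrees. Needs B-free named facts for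
Zucker/Conte–Murre (the tree has only the B-relative predicates ZuckerCubicFourfoldStatement /
ConteMurreQuarticQuinticStatement in Motives/Sweep1). [difficulty: M] -/
@[route_item "route-HodgeConjecture-LimitExtension", crux]
def HypersurfaceHodgeFourLowDegree : Prop :=
  ∀ ⦃d : ℕ⦄ ⦃X : Literature.AlgebraicGeometry.Motives.SchemeOver ℂ⦄, d ≤ 5 → Literature.AlgebraicGeometry.Motives.IsSmoothHypersurface 4 d X → Literature.AlgebraicGeometry.HodgeTheory.HodgeConjectureFor 4 X

-- `HypersurfaceHodgeFourLowDegree` holds: proved by `Summit.HodgeConjecture.HodgeConjecture.Theorems.hypersurfaceHodgeFourLowDegree_proof` @ 4bff057e565d (its module imports this route file, so no `_holds` link can be stated here).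

/-- item stmt-HodgeConjecture-3050 · support · rank 9 · closed · proved by Summit.HodgeConjecture.HodgeConjecture.Theorems.curveNetMordellWeil_hodgeModels_proof @ 614fa71ac06a (prover) · by planner
[support] Every smooth projective complex variety has a Hodge model (analytification + natural de
Rham comparison + Hodge decomposition): literally ∀ n X,
Literature.AlgebraicGeometry.HodgeTheory.nonempty_hodgeModel n X (named fact,
HodgeModelExistence.lean; conditional assembly nonempty_hodgeModel_of in HodgeModelExistenceProofs).
Supplies the anti-vacuity conjunct of HodgeConjectureFor in the Assembly. Sources: SerreGAGA1956,
VoisinHodgeI2002 Thm 6.18. -/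
@[route_item "route-HodgeConjecture-LimitExtension", crux]
def HodgeModels : Prop :=
  ∀ ⦃n : ℕ⦄ ⦃X : Literature.AlgebraicGeometry.Motives.SchemeOver ℂ⦄, Literature.AlgebraicGeometry.Motives.IsSmoothProjective n X → Nonempty (Literature.AlgebraicGeometry.HodgeTheory.HodgeModel n X)

/-- `HodgeModels` holds: proved by `Summit.HodgeConjecture.HodgeConjecture.Theorems.curveNetMordellWeil_hodgeModels_proof` @ 614fa71ac06a. -/
theorem HodgeModels_holds : HodgeModels := _root_.Summit.HodgeConjecture.HodgeConjecture.Theorems.curveNetMordellWeil_hodgeModels_proof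

-- earlier Assembly (stmt-HodgeConjecture-3004, replaced 2026-08-15T16:26:52Z -> stmt-HodgeConjecture-10868): retired by None — (∀ (n : ℕ) (X : Literature.AlgebraicGeometry.Motives.SchemeOver ℂ), Literature.AlgebraicGeometry.HodgeTheory.nonempty_hodgeModel n X) → LimitExtensionMid → HypersurfaceHodge → HodgeConjecture
/-- item stmt-HodgeConjecture-10868 · assembly · rank 1 · open · by planner
sources: Thomas2005Nodes, Deligne2000
[assembly] HodgeModels (inline: ∀ n X smooth projective, Nonempty (HodgeModel n X); 2026-08-15
route-repair, definitionally equal to the rev-0 spelling ∀ n X, nonempty_hodgeModel n X) →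
LimitExtensionMid → HypersurfaceHodge → HodgeConjecture: propositional from PullbackGlue and
MiddleDivisorSupportSuffices (Sketch.lean: `example (g1 : PullbackGlue) (g2 :
MiddleDivisorSupportSuffices) : Assembly := fun m a b => g2 m (g1 a b)`, rc 0). The Hodge-model
antecedent is the shared support item HodgeModels (stmt-HodgeConjecture-3050) that the sibling
routes use. The route's DECIDING THEOREM is `closes` (all listed items → HodgeConjecture, proof h₈
h₁₂ (h₇ h₁ h₂)); this item is its propositional summary. [deps: PullbackGlue,
MiddleDivisorSupportSuffices, HodgeModels] -/
@[route_item "route-HodgeConjecture-LimitExtension", crux]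
def Assembly : Prop :=
  (∀ ⦃n : ℕ⦄ ⦃X : Literature.AlgebraicGeometry.Motives.SchemeOver ℂ⦄, Literature.AlgebraicGeometry.Motives.IsSmoothProjective n X → Nonempty (Literature.AlgebraicGeometry.HodgeTheory.HodgeModel n X)) → LimitExtensionMid → HypersurfaceHodge → HodgeConjecture

/-! D-0027 §2.1 — DECIDING THEOREM (planner-authored via `route open/edit --closes-file`; by planner-rbadge-HodgeConjecture-LimitExtension-85272f30-g2-0 2026-08-15T16:27:58Z):
its hypotheses are this route's items and its conclusion the sub-problem Statement (glue_lint), and it elaborates with this file. -/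

/-- D-0027 §2.1 deciding theorem of route LimitExtension. The chain is
`PullbackGlue : LimitExtensionMid → HypersurfaceHodge → MiddleDivisorSupport` (limit extension of
middle Hodge classes + HC on the smooth hypersurface fibres ⟹ every middle class is supported on a
divisor, via the Hodge-free specialisation lemma) followed by
`MiddleDivisorSupportSuffices : (HodgeModels, inline) → MiddleDivisorSupport → HodgeConjecture`
(the Thomas / de Cataldo–Migliorini induction on dimension), the support item `HodgeModels`
discharging the anti-vacuity conjunct of `HodgeConjectureFor`. The other listed items — the fourfold
calibration `LimitExtensionFour`, `HypersurfaceHodgeFour`, `HodgeFourfolds`,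
`HypersurfaceHodgeFourLowDegree`; the shared crux `MiddleDivisorSupport` (here the OUTPUT of
`PullbackGlue`); the lemma `SpecialisationOfAlgebraicity` behind `PullbackGlue`; the bridge
`HypersurfacesSufficeOfLE`; and the propositional summary `Assembly` (itself
`fun m a b => h₈ m (h₇ a b)`) — ride along as hypotheses of the gate's canonical type and are not
used by the implication. -/
@[closes "route-HodgeConjecture-LimitExtension"] theorem closes (h₁ : LimitExtensionMid) (h₂ : HypersurfaceHodge) (_h₃ : LimitExtensionFour)
    (_h₄ : HypersurfaceHodgeFour) (_h₅ : MiddleDivisorSupport) (_h₆ : SpecialisationOfAlgebraicity)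
    (h₇ : PullbackGlue) (h₈ : MiddleDivisorSupportSuffices) (_h₉ : HypersurfacesSufficeOfLE)
    (_h₁₀ : HodgeFourfolds) (_h₁₁ : HypersurfaceHodgeFourLowDegree) (h₁₂ : HodgeModels)
    (_h₁₃ : Assembly) : _root_.HodgeConjecture :=
  h₈ h₁₂ (h₇ h₁ h₂)

end Summit.HodgeConjecture.HodgeConjecture.Theses.LimitExtension
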